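import Mathlib
import HarnessLib
import Literature.MathematicalPhysics.StatisticalMechanics.LastScaleKernelLineSecondDiffTorusFRD
import Literature.MathematicalPhysics.StatisticalMechanics.StepOperatorASecondDiffTorusFRD
import Literature.MathematicalPhysics.StatisticalMechanics.ParallelogramSecondDiff

/-!
# The `ℓ = 2` slot of the last integration step on PARALLELOGRAMS of tuning parameters (family F4Φ22),
# uniformly in `N`: `‖Φ(q+y+z) − Φ(q+y) − Φ(q+z) + Φ(q)‖ ≤ φ_TT · Σ|y| · Σ|z| · c_y`, `Φ(q) = ∫ y(Λ) dμ^{(q)}_{N+1}`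
# ([ABKM19] Lemma 8.4 / Lemma 12.6 with `ℓ = 2`, last scale)

From the LINE form `norm_integral_last_kernel_lineSecondDiff_le_of_torusFRD` (both halves of the second
difference along `x, x+h, x+2h`, quadratic in `h`, `N`-free) to mixed second differences on parallelograms in
the ball `Σ|·| ≤ T₀` by `ParallelogramSecondDiff.norm_secondDiff_le_bilinear` on the sup-normed space of
matrices (`Σ|h| ≤ d²‖h‖_∞`, `‖y‖_∞ ≤ Σ|y|`, `Σ|2h| ≤ 1` on the ball so `e^{2KΣ|2h|} ≤ e^{2K}`):

* **`norm_integral_last_kernel_paraSecondDiff_le_of_torusFRD`** — with the explicit `N`-free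
  `φ_TT = 4 A⁻¹ (r₀+1) κ d⁴ (108 q_H² 3^{d+1} e^{4K} K² + 8 q_H 3^{(d+1)/2} K⁽²⁾)`,
  `K = shellRatioConst c (Cℓ 1) L d ñ`, `K⁽²⁾ = shellRatioConst c (Cℓ 2) L d ñ`, `κ = A𝒫(ρ'')^{1/p}`.

This is the shape of the slot `F4Φ22` of `AbkmPackageSlots` (up to the `activitySpace` packaging of `y`).
Everything is proved; no named fact.

## References
* S. Adams, S. Buchholz, R. Kotecký, S. Müller, arXiv:1910.13564, Lemma 8.4, (12.15), Lemma 12.6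
  [AdamsBuchholzKoteckyMuller2019].
* S. Buchholz, J. Funct. Anal. 275 (2018), Thm 4.5 [Buchholz2016].
-/

noncomputable section

namespace Literature.MathematicalPhysics.StatisticalMechanics.GradientRG

open scoped BigOperators Classical
open Real Finset MeasureTheory
open Literature.MathematicalPhysics.StatisticalMechanics.GradientFRD
  (fourierCoeff cExt cExt_of_mem IsElliptic IsUnitSymm InShell iterDiff supNorm conv ellOp isElliptic_one)
open Literature.MathematicalPhysics.StatisticalMechanics.TorusPolymer (IsPolymer numBlocks isPolymer_univ)
open Literature.Barriers.CriticalPhenomena.LongRangePhi4.Polymer (IsConn)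
open Literature.MathematicalPhysics.QuantumFieldTheory

variable {d M : ℕ} [NeZero M]

section Package

variable {L N Mord R n ñ : ℕ} {θbar lam μ δ₁ δ₀ A𝒫 : ℝ}
    {𝒞 : Matrix (Fin d) (Fin d) ℝ → ℕ → (Fin d → ZMod M) → ℝ} {Mc : ℕ → ℝ}
    {Cα : (Fin d → ℕ) → ℕ → ℝ} {c C : ℝ} {Cℓ : ℕ → ℝ}

set_option maxHeartbeats 1600000 in
/-- **The `ℓ = 2` slot of the last integration step on parallelograms, uniformly in `N`** (family F4Φ22):
for one `TorusFRD` package with the gap `d + 1 ≤ 2(ñ−n)`, symmetric `q, q+y, q+z, q+y+z` in the ball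
`Σ|·| ≤ T₀ ≤ ½` (`K T₀ ≤ log(1+ρ)`, `ρ < θ̄`), Hölder conjugates `p, q_H` with `p(1+ρ) ≤ 1+ρ''` (`ρ'' < θ̄`), and a
functional `y` with `‖y‖_N^{(A)} ≤ c_y`, `C^{r₀}`, `T_N^{Λ*}`-local:
`‖Φ(q+y+z) − Φ(q+y) − Φ(q+z) + Φ(q)‖ ≤ φ_TT · Σ|y| · Σ|z| · c_y` with the `N`-free
`φ_TT = 4 A⁻¹ (r₀+1) κ d⁴ (108 q_H² 3^{d+1} e^{4K} K² + 8 q_H 3^{(d+1)/2} K⁽²⁾)`.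
[cite: AdamsBuchholzKoteckyMuller2019, Lemma 8.4 / (12.15) / Lemma 12.6] -/
theorem norm_integral_last_kernel_paraSecondDiff_le_of_torusFRD
    (hd : 3 ≤ d) (hMord : 1 ≤ Mord) (hMR : Mord ≤ R) (hLodd : Odd L) (hL : 2 ^ (d + 3) + 16 * R ≤ L)
    (hM : M = L ^ N)
    (hθbar : 0 < θbar) (hlam : 0 < lam) (hn : 2 * Mord ≤ n) (hn2 : 2 ≤ n) (hnñ : n ≤ ñ)
    (hgap : d + 1 ≤ 2 * (ñ - n))
    (hc : 0 < c) (hC1 : 0 ≤ Cℓ 1) (hC2 : 0 ≤ Cℓ 2)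
    (hallA : ∀ A : Matrix (Fin d) (Fin d) ℝ, IsElliptic (1 / 2 : ℝ) 2 A →
        (∀ k, 1 ≤ k → k ≤ N + 1 →
          ∑ x : Fin d → ZMod M, 𝒞 A k x = 0 ∧ ∀ x, 𝒞 A k (-x) = 𝒞 A k x) ∧
        (∀ k, 1 ≤ k → k ≤ N + 1 → ∀ φ : (Fin d → ZMod M) → ℝ, ∑ x, φ x = 0 →
          0 ≤ ∑ x, ∑ y, φ x * 𝒞 A k (x - y) * φ y) ∧
        (∀ φ : (Fin d → ZMod M) → ℝ, ∑ x, φ x = 0 →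
          ellOp A (conv (fun x => ∑ k ∈ Finset.Icc 1 (N + 1), 𝒞 A k x) φ) = φ) ∧
        (∀ k, 1 ≤ k → k ≤ N → Mc k ≤ 0 ∧
          ∀ x : Fin d → ZMod M, ((L : ℝ) ^ k) / 2 ≤ (supNorm x : ℝ) →
            𝒞 A k x = Mc k) ∧
        (∀ k, 1 ≤ k → k ≤ N + 1 → ∀ B : Matrix (Fin d) (Fin d) ℝ, IsUnitSymm B →
          (∃ ε : ℝ, 0 < ε ∧ ∀ x : Fin d → ZMod M,
            ContDiffOn ℝ ⊤ (fun s : ℝ => 𝒞 (A + s • B) k x) (Set.Ioo (-ε) ε)) ∧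
          ∀ α : Fin d → ℕ, ∑ i, α i ≤ n → ∀ ℓ : ℕ, ∀ x : Fin d → ZMod M,
            abs (iteratedDeriv ℓ (fun s : ℝ => iterDiff α (𝒞 (A + s • B) k) x) 0)
              ≤ Cα α ℓ / (L : ℝ) ^ ((k - 1) * (d - 2 + ∑ i, α i))) ∧
        (∀ k, 1 ≤ k → k ≤ N + 1 → ∀ j : ℕ, ∀ κ : Fin d → ZMod M, κ ≠ 0 → InShell L j κ →
          (j < k →
            c / (L : ℝ) ^ (2 * (d + ñ) + 1) * (L : ℝ) ^ (2 * j)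
                / (L : ℝ) ^ ((k - j) * (d - 1 + n)) ≤ (fourierCoeff (𝒞 A k) κ).re ∧
            ‖fourierCoeff (𝒞 A k) κ‖
              ≤ C * (L : ℝ) ^ (2 * (d + ñ) + 1) * (L : ℝ) ^ (2 * j)
                  / (L : ℝ) ^ ((k - j) * (d - 1 + n))) ∧
          (k ≤ j →
            c / (L : ℝ) ^ (2 * (d + ñ) + 1) * (L : ℝ) ^ (2 * k)
                ≤ (fourierCoeff (𝒞 A k) κ).re ∧
            ‖fourierCoeff (𝒞 A k) κ‖ ≤ C * (L : ℝ) ^ (2 * k)) ∧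
          ∀ B : Matrix (Fin d) (Fin d) ℝ, IsUnitSymm B → ∀ ℓ : ℕ, 1 ≤ ℓ →
            (j < k →
              ‖iteratedDeriv ℓ (fun s : ℝ => fourierCoeff (𝒞 (A + s • B) k) κ) 0‖
                ≤ Cℓ ℓ * (L : ℝ) ^ (2 * (d + ñ) + 1) * (L : ℝ) ^ (2 * j)
                    / (L : ℝ) ^ ((k - j) * (d - 1 + ñ))) ∧
            (k ≤ j →
              ‖iteratedDeriv ℓ (fun s : ℝ => fourierCoeff (𝒞 (A + s • B) k) κ) 0‖
                ≤ Cℓ ℓ * (L : ℝ) ^ (2 * k))))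
    (hB : AbkmWeightBounds L N Mord R n θbar lam μ δ₁ δ₀ A𝒫 (fun j => 𝒞 1 j)
      (abkmWeightData L N Mord R θbar (schedDelta δ₀ δ₁ N) fun j => 𝒞 1 j))
    {ρ : ℝ} (hρ0 : 0 ≤ ρ) (hρ : ρ < θbar)
    {T₀ : ℝ} (hT₀ : T₀ ≤ 1 / 2) (hKT₀ : shellRatioConst c (Cℓ 1) (L : ℝ) d ñ * T₀ ≤ Real.log (1 + ρ))
    {q yq zq : Matrix (Fin d) (Fin d) ℝ}
    (hq : q.IsSymm ∧ ∑ i, ∑ j, |q i j| ≤ T₀) (hqy : (q + yq).IsSymm ∧ ∑ i, ∑ j, |(q + yq) i j| ≤ T₀)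
    (hqz : (q + zq).IsSymm ∧ ∑ i, ∑ j, |(q + zq) i j| ≤ T₀)
    (hqyz : (q + yq + zq).IsSymm ∧ ∑ i, ∑ j, |(q + yq + zq) i j| ≤ T₀)
    {p qH ρ'' : ℝ} (hpq : p.HolderConjugate qH) (hρ''0 : 0 ≤ ρ'') (hρ'' : ρ'' < θbar)
    (hpρ : p * (1 + ρ) ≤ 1 + ρ'')
    {pT r₀ : ℕ} {h A : ℝ} (hA : 0 < A)
    {y : Finset (Fin d → ZMod M) → ((Fin d → ZMod M) → ℝ) → ℂ} {cy : ℝ} (hcy : 0 ≤ cy)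
    (hy : WeakNormLE (abkmNormParams L N Mord R pT r₀ h θbar A (schedDelta δ₀ δ₁ N) fun j => 𝒞 1 j) N y cy)
    (hyd : ContDiff ℝ r₀ (y univ))
    (hyloc : IsGaugeLocal ((abkmNormParams L N Mord R pT r₀ h θbar A (schedDelta δ₀ δ₁ N) fun j => 𝒞 1 j).gauge N univ)
      (y univ)) :
    ‖(∫ φ, y univ φ ∂(stepMeasure (𝒞 ((1 : Matrix (Fin d) (Fin d) ℝ) + (q + yq + zq)) (N + 1)))) -
        (∫ φ, y univ φ ∂(stepMeasure (𝒞 ((1 : Matrix (Fin d) (Fin d) ℝ) + (q + yq)) (N + 1)))) -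
        (∫ φ, y univ φ ∂(stepMeasure (𝒞 ((1 : Matrix (Fin d) (Fin d) ℝ) + (q + zq)) (N + 1)))) +
        ∫ φ, y univ φ ∂(stepMeasure (𝒞 ((1 : Matrix (Fin d) (Fin d) ℝ) + q) (N + 1)))‖ ≤
      4 * (A⁻¹ * (r₀ + 1) *
          weightIntConstRho θbar ρ'' (traceConst d Mord R lam (derivSum d n fun θ' _ => Cα θ' 0)) ^ (1 / p) *
          (d : ℝ) ^ 4 *
          (108 * qH ^ 2 * (3 : ℝ) ^ (d + 1) * Real.exp (4 * shellRatioConst c (Cℓ 1) (L : ℝ) d ñ) *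
              shellRatioConst c (Cℓ 1) (L : ℝ) d ñ ^ 2 +
            8 * qH * Real.sqrt ((3 : ℝ) ^ (d + 1)) * shellRatioConst c (Cℓ 2) (L : ℝ) d ñ)) *
        (∑ i, ∑ j, |yq i j|) * (∑ i, ∑ j, |zq i j|) * cy := by
  have hA0 : 0 < A := hA
  have hq1 : 0 ≤ qH := by linarith [hpq.symm.lt]
  set K₁ := shellRatioConst c (Cℓ 1) (L : ℝ) d ñ with hK₁
  set K₂ := shellRatioConst c (Cℓ 2) (L : ℝ) d ñ with hK₂
  have hK₁0 : 0 ≤ K₁ := shellRatioConst_nonneg hc hC1 (Nat.cast_nonneg _) d ñ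
  have hK₂0 : 0 ≤ K₂ := shellRatioConst_nonneg hc hC2 (Nat.cast_nonneg _) d ñ
  set κ := weightIntConstRho θbar ρ'' (traceConst d Mord R lam (derivSum d n fun θ' _ => Cα θ' 0)) ^ (1 / p) with hκ
  have hA𝒫p : 0 ≤ weightIntConstRho θbar ρ'' (traceConst d Mord R lam (derivSum d n fun θ' _ => Cα θ' 0)) :=
    zero_le_one.trans (one_le_weightIntConstRho hθbar hρ''0 hρ''
      (traceConst_nonneg d Mord R hlam.le (derivSum_nonneg d n _)))
  have hκ0 : 0 ≤ κ := Real.rpow_nonneg hA𝒫p _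
  set S3 := Real.sqrt ((3 : ℝ) ^ (d + 1)) with hS3
  have hS30 : 0 ≤ S3 := Real.sqrt_nonneg _
  have hS3sq : S3 ^ 2 = (3 : ℝ) ^ (d + 1) := Real.sq_sqrt (by positivity)
  -- the function on the sup-normed space of matrices and the convex ball
  set s : Set (Fin d → Fin d → ℝ) := {m | (Matrix.of m).IsSymm ∧ ∑ i, ∑ j, |m i j| ≤ T₀} with hs
  have hsc : Convex ℝ s := convex_symmBall T₀
  set f : (Fin d → Fin d → ℝ) → ℂ := fun m =>
    ∫ φ, y univ φ ∂(stepMeasure (𝒞 ((1 : Matrix (Fin d) (Fin d) ℝ) + Matrix.of m) (N + 1))) with hf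
  set Mc : ℝ := cy * A⁻¹ * (r₀ + 1) * κ * (d : ℝ) ^ 4 *
    (108 * qH ^ 2 * (3 : ℝ) ^ (d + 1) * Real.exp (4 * K₁) * K₁ ^ 2 + 8 * qH * S3 * K₂) with hMc
  have hMc0 : 0 ≤ Mc := by positivity
  -- the line hypothesis
  have hline : ∀ x w : Fin d → Fin d → ℝ, x ∈ s → x + w ∈ s → x + (2 : ℝ) • w ∈ s →
      ‖f (x + (2 : ℝ) • w) - (2 : ℝ) • f (x + w) + f x‖ ≤ Mc * ‖w‖ ^ 2 := by
    intro x w hx hxw hx2w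
    have hwsymm : (Matrix.of w).IsSymm := by
      have : Matrix.of w = Matrix.of (x + w) - Matrix.of x := by simp
      rw [this]; exact hxw.1.sub hx.1
    have hl := norm_integral_last_kernel_lineSecondDiff_le_of_torusFRD hd hMord hMR hLodd hL hM hθbar hlam hn hn2 hnñ
      hgap hc hC1 hC2 hallA hB hρ0 hρ hT₀ hKT₀ (q := Matrix.of x) (yq := Matrix.of w) hx.1 hwsymm hx.2 hxw.2 hx2w.2
      hpq hρ''0 hρ'' hpρ hA hcy hy hyd hyloc (pT := pT) (r₀ := r₀) (h := h)
    -- sizes of the direction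
    set T₁ := ∑ i, ∑ j, |w i j| with hT₁
    have hT₁0 : 0 ≤ T₁ := sum_nonneg fun _ _ => sum_nonneg fun _ _ => abs_nonneg _
    have hT₂ : ∑ i, ∑ j, |((2 : ℝ) • Matrix.of w) i j| = 2 * T₁ := by
      rw [hT₁, mul_sum]
      refine sum_congr rfl fun i _ => ?_
      rw [mul_sum]
      refine sum_congr rfl fun j _ => ?_
      simp [abs_mul]
    have hT₂le : 2 * T₁ ≤ 1 := by
      have h1 : ∑ i, ∑ j, |((2 : ℝ) • w) i j| ≤ ∑ i, ∑ j, (|(x + (2 : ℝ) • w) i j| + |x i j|) := by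
        refine sum_le_sum fun i _ => sum_le_sum fun j _ => ?_
        have : ((2 : ℝ) • w) i j = (x + (2 : ℝ) • w) i j - x i j := by simp
        rw [this]; exact abs_sub _ _
      have h2 : ∑ i, ∑ j, (|(x + (2 : ℝ) • w) i j| + |x i j|) =
          (∑ i, ∑ j, |(x + (2 : ℝ) • w) i j|) + ∑ i, ∑ j, |x i j| := by
        rw [← sum_add_distrib]; exact sum_congr rfl fun i _ => sum_add_distrib
      have h3 : ∑ i, ∑ j, |((2 : ℝ) • w) i j| = 2 * T₁ := hT₂
      linarith [hx.2, hx2w.2, hT₀]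
    have hTn : T₁ ≤ (d : ℝ) ^ 2 * ‖w‖ := entrySum_le_sq_mul_norm w
    have hexp : Real.exp (2 * K₁ * (2 * T₁)) ≤ Real.exp (2 * K₁) := by
      refine Real.exp_le_exp.2 ?_
      calc 2 * K₁ * (2 * T₁) ≤ 2 * K₁ * 1 := mul_le_mul_of_nonneg_left hT₂le (by positivity)
        _ = 2 * K₁ := mul_one _
    rw [hT₂] at hl
    have hfx : f (x + (2 : ℝ) • w) - (2 : ℝ) • f (x + w) + f x =
        (∫ φ, y univ φ ∂(stepMeasure (𝒞 ((1 : Matrix (Fin d) (Fin d) ℝ) + (Matrix.of x + (2 : ℝ) • Matrix.of w)) (N + 1)))) -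
        (2 : ℝ) • (∫ φ, y univ φ ∂(stepMeasure (𝒞 ((1 : Matrix (Fin d) (Fin d) ℝ) + (Matrix.of x + Matrix.of w)) (N + 1)))) +
        ∫ φ, y univ φ ∂(stepMeasure (𝒞 ((1 : Matrix (Fin d) (Fin d) ℝ) + Matrix.of x) (N + 1))) := rfl
    rw [hfx]
    refine hl.trans ?_
    -- bound the two halves by `Mc ‖w‖²`
    have hE : 2 * T₁ * Real.exp (2 * K₁ * (2 * T₁)) * K₁ ≤ 2 * ((d : ℝ) ^ 2 * ‖w‖) * Real.exp (2 * K₁) * K₁ := by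
      gcongr
    have hE0 : 0 ≤ 2 * T₁ * Real.exp (2 * K₁ * (2 * T₁)) * K₁ := by positivity
    have hsq1 : (S3 * (2 * T₁ * Real.exp (2 * K₁ * (2 * T₁)) * K₁)) ^ 2 ≤
        (S3 * (2 * ((d : ℝ) ^ 2 * ‖w‖) * Real.exp (2 * K₁) * K₁)) ^ 2 :=
      pow_le_pow_left₀ (mul_nonneg hS30 hE0) (mul_le_mul_of_nonneg_left hE hS30) 2
    have hsq2 : T₁ ^ 2 ≤ ((d : ℝ) ^ 2 * ‖w‖) ^ 2 := pow_le_pow_left₀ hT₁0 hTn 2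
    have hexp2 : Real.exp (2 * K₁) ^ 2 = Real.exp (4 * K₁) := by
      rw [← Real.exp_nat_mul]; congr 1; ring
    calc cy * A⁻¹ * ((r₀ + 1) * (27 * qH ^ 2 * (S3 * (2 * T₁ * Real.exp (2 * K₁ * (2 * T₁)) * K₁)) ^ 2)) * κ +
          2 * (cy * A⁻¹ * ((r₀ + 1) * (8 * qH * (S3 * (2⁻¹ * T₁ ^ 2 * K₂)))) * κ)
        ≤ cy * A⁻¹ * ((r₀ + 1) * (27 * qH ^ 2 * (S3 * (2 * ((d : ℝ) ^ 2 * ‖w‖) * Real.exp (2 * K₁) * K₁)) ^ 2)) * κ +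
          2 * (cy * A⁻¹ * ((r₀ + 1) * (8 * qH * (S3 * (2⁻¹ * ((d : ℝ) ^ 2 * ‖w‖) ^ 2 * K₂)))) * κ) := by
          gcongr
      _ = Mc * ‖w‖ ^ 2 := by
          rw [hMc, mul_pow S3, hS3sq, mul_pow, mul_pow, mul_pow, hexp2]
          ring
  -- apply the bilinear lemma
  have hq' : (q : Fin d → Fin d → ℝ) ∈ s := hq
  have hqy' : (q : Fin d → Fin d → ℝ) + yq ∈ s := hqy
  have hqz' : (q : Fin d → Fin d → ℝ) + zq ∈ s := hqz
  have hqyz' : (q : Fin d → Fin d → ℝ) + yq + zq ∈ s := hqyz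
  have hbil := norm_secondDiff_le_bilinear hsc hMc0 hline hq' hqy' hqz' hqyz'
  refine le_trans (le_of_eq rfl) (hbil.trans ?_)
  have hy' : ‖Matrix.of.symm yq‖ ≤ ∑ i, ∑ j, |yq i j| := norm_le_entrySum _
  have hz' : ‖Matrix.of.symm zq‖ ≤ ∑ i, ∑ j, |zq i j| := norm_le_entrySum _
  have hMc4 : 0 ≤ 4 * Mc := by positivity
  calc 4 * Mc * ‖Matrix.of.symm yq‖ * ‖Matrix.of.symm zq‖
      ≤ 4 * Mc * (∑ i, ∑ j, |yq i j|) * (∑ i, ∑ j, |zq i j|) :=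
        mul_le_mul (mul_le_mul_of_nonneg_left hy' hMc4) hz' (norm_nonneg _) (mul_nonneg hMc4 (entrySum_nonneg yq))
    _ = _ := by rw [hMc]; ring

end Package

end Literature.MathematicalPhysics.StatisticalMechanics.GradientRG

end
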